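import Summits.QuantumFields.BalabanUV.Beta.WardBorderReflectionWall
import Summits.QuantumFields.BalabanUV.Beta.WardBorderReflectionContactMirror
import Summits.QuantumFields.BalabanUV.Beta.WardBorderReflectionContactAxisMirror

/-!
# `BalabanUV.Beta.WardBorderReflectionWallBlocks` — binder row D1, (L4): «D1-hRhW-SOCKET-CONSISTENCY» part 2d — THE WALL INSTANCES of parts
# 2a′ ∕ 2b ∕ 2b′: the level-0 hR border contact `wallD₀` against the hW border Ward datum on the remaining three border blocks

HONEST FRAMING (cell charter, verbatim): «discharging BetaPertH makes Balaban's UV stability UNCONDITIONAL — a real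
constructive-QFT result; it is NOT the continuum limit and NOT the Clay problem.»  Neutral [folklore] bookkeeping BY NAME, as in part 2c
(`WardBorderReflectionWall`): the abstract identities `WardBorderReflectionContactMirror.canonD_ward_eq_defect_inr_inl`,
`WardBorderReflectionContactAxis.canonD_ward_eq_defect_inl_inr_axis`, `WardBorderReflectionContactAxisMirror.canonD_ward_eq_defect_inr_inl_axis` with
their hypotheses DISCHARGED for the wall's level-0 datum `(𝕄₀, S₀) = (bhKStepAt 3 ρ_c Lc 0, SpureRecAt 3 Lc ρ_c Lc⁴ (−Lc⁸∕2) cΛ 0)`: (H0) packing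
support (`packVH` ∕ `bhKAt` guards `off = 0`), (H1) := an2-g20's `actS_SpureRecAt_zero`, (H2) := g3's `divV_vhSAt_inl_inr` ∕ `_inr_inl` summed over the
block + leaf-06's `bhKAt_inl_inr_eq_linSymAt` ∕ `_inr_inl_eq_linSymAt`, `s·γ₀ = Lc⁻⁴·(−Lc⁴∕2) = −½`.  No statement of Bałaban's papers, no `[cite:]`,
no `def`; instantiates NO binder of the β-function wall (0/4: hW, hR, D1Tel, D1Rep); NOT hW, NOT hR, NOT D1, NOT `BetaPertH`, NOT continuum, NOT Clay.
HONEST DEPENDENCY: continuum YM on T⁴ ⇐ BetaPertH ∧ nine spine estimates (0/9 proved); BetaPertH ⇐ (D1) ∧ (D4) ∧ CAP+tail;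
G-an2-4 gates asym, D1 and NE2/3/4.

CONTENT (`d = 3`, odd `Lc`, the END's `hγ`): §1 (H2) on the mirror block `sum_divV_Spure0_inr_inl`; §2 (H0) `Spure0_inl_inr_of_off`, `Spure0_inr_inl_of_off`,
`bhK0_inl_inr_of_off`, `bhK0_inr_inl_of_off`; §3 **`wallD₀_ward_eq_defect_inr_inl`** (`m ≠ α`), **`wallD₀_ward_eq_defect_inl_inr_axis`**,
**`wallD₀_ward_eq_defect_inr_inl_axis`** — with part 2c's `wallD₀_ward_eq_defect_inl_inr` the consistency identity of part 1 holds for the wall's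
level-0 contact at EVERY border entry.  The assembled kernel statement for `Bwall` against the END's `c′•vhSAt` datum is part 2e.
Provenance: β sub-cell, D1 formalisation swarm, unit b2b-balaban-beta-d1-formalise-leaf-04 gen 4, 2026-08-20 (v1); no existing file touched.
-/

open Finset
open scoped BigOperators
open Literature.MathematicalPhysics.QuantumFieldTheory
open Literature.MathematicalPhysics.QuantumFieldTheory.Balaban1983to89
open Literature.MathematicalPhysics.QuantumFieldTheory.Balaban1983to89.Beta
open ExpKernelCalculus (MKer)
open AffineAveraging (box toSite)
open AveragingContours (blk off)
open AveragingContoursRooted (ctr ctrOff)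
open AveragingHessianKernels (packVH_inl_inr packVH_inr_inl)
open AveragingHessianKernelsRooted (vhSAt linKerAt)
open KernelWard (divV)
open PolarizationSign (reflSign)
open KernelReflection (LegMap refK refK_apply)
open ResolventReflection (sref bref mref Φ)
open OneStepResolventKernel (Fib)
open StepJetData (wilsonA)
open BalabanStepJetsSucc (wE wVH)
open Summit.QuantumFields.BalabanUV.Beta.TameKernelCalculus
open Summit.QuantumFields.BalabanUV.Beta.ChartConjugation (conjV)
open Summit.QuantumFields.BalabanUV.Beta.BorderedHessian (diagK diagK_apply conjV_diagK_apply ctGen bhKAt bhKStepAt bhKStepAt_zero stepScale)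
open Summit.QuantumFields.BalabanUV.Beta.AveragingWardRootedStencils (linSymAt linSymAt_inl_inr linSymAt_inr_inl legInd divV_vhSAt_inr_inl)
open Summit.QuantumFields.BalabanUV.Beta.WardLocusStencils (bhKAt_inl_inr_eq_linSymAt bhKAt_inr_inl_eq_linSymAt)
open Summit.QuantumFields.BalabanUV.Beta.WilsonReflectionContact (wilsonA_inl_inr wilsonA_inr_inl)
open Summit.QuantumFields.BalabanUV.Beta.SpineRooted (SpureRecAt SpureRecAt_zero_level)
open Summit.QuantumFields.BalabanUV.Beta.SecondOrderBorderGauge (actS canonD)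
open Summit.QuantumFields.BalabanUV.Beta.SecondOrderBorderGaugeWall (wallD₀ actS_SpureRecAt_zero)
open Summit.QuantumFields.BalabanUV.Beta.WardBorderReflectionContact (dSym_inl dSym_inr)
open Summit.QuantumFields.BalabanUV.Beta.WardBorderReflectionContactMirror (canonD_ward_eq_defect_inr_inl)
open Summit.QuantumFields.BalabanUV.Beta.WardBorderReflectionContactAxis (canonD_ward_eq_defect_inl_inr_axis)
open Summit.QuantumFields.BalabanUV.Beta.WardBorderReflectionContactAxisMirror (canonD_ward_eq_defect_inr_inl_axis)
open Summit.QuantumFields.BalabanUV.Beta.WardBorderReflectionWall (gamma_zero_eq sum_divV_Spure0_inl_inr)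

namespace Summit.QuantumFields.BalabanUV.Beta.WardBorderReflectionWallBlocks

noncomputable section

variable {Lc : ℕ} [NeZero Lc]

/-! ## §1 The first-order block Ward law (H2) on the mirror block -/

/-- [folklore] **SITE LAW**, mirror block `(x, inr m; z, inl β)`: `divV S₀ y (e′) = ([x + ρ_c = y] − [z = y]) · (−Lc⁸∕2) · linSymAt ρ_c Lc (e′)`. -/
theorem divV_Spure0_inr_inl (cΛ : ℝ) (y x z : Fin 4 → ℤ) (m β : Fin 4) :
    divV (SpureRecAt 3 Lc (toSite (ctrOff 4 Lc)) ((Lc : ℝ) ^ 4) (-((Lc : ℝ) ^ 8 / 2)) cΛ 0) y x z (Sum.inr m) (Sum.inl β) =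
      ((if x + toSite (ctrOff 4 Lc) = y then (1 : ℝ) else 0) - (if z = y then 1 else 0)) *
        (-((Lc : ℝ) ^ 8 / 2) * linSymAt (toSite (ctrOff 4 Lc)) Lc x z (Sum.inr m) (Sum.inl β)) := by
  have hL : 1 ≤ Lc := Nat.one_le_iff_ne_zero.mpr (NeZero.ne Lc)
  have hv := divV_vhSAt_inr_inl (d := 3) hL (toSite (ctrOff 4 Lc)) y x z m β
  simp only [KernelWard.divV, Finset.sum_apply, Pi.sub_apply] at hv ⊢
  simp only [SpureRecAt_zero_level, Pi.add_apply, Pi.smul_apply, smul_eq_mul, wilsonA_inr_inl, mul_zero, zero_add]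
  have : ∑ κ : Fin 4, ((-((Lc : ℝ) ^ 8 / 2)) * vhSAt (toSite (ctrOff 4 Lc)) 3 Lc rfl κ (y - B6BondElimination.unitVec κ) x z (Sum.inr m) (Sum.inl β) -
      (-((Lc : ℝ) ^ 8 / 2)) * vhSAt (toSite (ctrOff 4 Lc)) 3 Lc rfl κ y x z (Sum.inr m) (Sum.inl β)) =
      (-((Lc : ℝ) ^ 8 / 2)) * ∑ κ : Fin 4, (vhSAt (toSite (ctrOff 4 Lc)) 3 Lc rfl κ (y - B6BondElimination.unitVec κ) x z (Sum.inr m) (Sum.inl β) -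
        vhSAt (toSite (ctrOff 4 Lc)) 3 Lc rfl κ y x z (Sum.inr m) (Sum.inl β)) := by
    rw [Finset.mul_sum]; refine Finset.sum_congr rfl fun κ _ => ?_; ring
  rw [this, hv]
  ring

/-- [folklore] **(H2) FOR THE WALL on the mirror block**: `(Σ_v divV S₀ (Lc•Y+v)) (e′) = ((−2γ₀) • conjV 𝕄₀ D_Y) (e′)` at `(x, inr m; z, inl β)`
(`𝕄₀ (e′) = +Lc⁴·linSymAt (e′)`). -/
theorem sum_divV_Spure0_inr_inl (cΛ : ℝ) (γ : ℕ → ℝ)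
    (hγ : ∀ j, γ j = -((Lc : ℝ) ^ 8 / 2) * wVH 3 Lc j / (stepScale 3 Lc j * (Lc : ℝ) ^ 4)) (Y x z : Fin 4 → ℤ) (m β : Fin 4) :
    (∑ v ∈ box 4 Lc, divV (SpureRecAt 3 Lc (toSite (ctrOff 4 Lc)) ((Lc : ℝ) ^ 4) (-((Lc : ℝ) ^ 8 / 2)) cΛ 0) ((Lc : ℤ) • Y + toSite v))
        x z (Sum.inr m) (Sum.inl β) =
      ((-2 * γ 0) • conjV (bhKStepAt 3 (toSite (ctrOff 4 Lc)) Lc 0)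
        (diagK ((1 / 2 : ℝ) • ∑ v ∈ box 4 Lc, legInd (toSite (ctrOff 4 Lc)) ((Lc : ℤ) • Y + toSite v)))) x z (Sum.inr m) (Sum.inl β) := by
  rw [Finset.sum_apply, Finset.sum_apply, Finset.sum_apply, Finset.sum_apply]
  simp only [divV_Spure0_inr_inl]
  rw [← Finset.sum_mul, Finset.sum_sub_distrib, Pi.smul_apply, Pi.smul_apply, Pi.smul_apply, Pi.smul_apply, smul_eq_mul,
    conjV_diagK_apply, dSym_inl, dSym_inr, bhKStepAt_zero, bhKAt_inr_inl_eq_linSymAt, gamma_zero_eq γ hγ]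
  ring

/-! ## §2 Packing support (H0) of the wall's level-0 datum -/

/-- [folklore] `S₀ κ u (x, inl β; z, inr m) = 0` unless `off Lc z = 0`. -/
theorem Spure0_inl_inr_of_off (cΛ : ℝ) (κ : Fin 4) (u x z : Fin 4 → ℤ) (β m : Fin 4) (hz : off Lc z ≠ 0) :
    SpureRecAt 3 Lc (toSite (ctrOff 4 Lc)) ((Lc : ℝ) ^ 4) (-((Lc : ℝ) ^ 8 / 2)) cΛ 0 κ u x z (Sum.inl β) (Sum.inr m) = 0 := by
  simp only [SpureRecAt_zero_level, Pi.add_apply, Pi.smul_apply, smul_eq_mul, wilsonA_inl_inr, mul_zero, zero_add]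
  rw [AveragingHessianKernelsRooted.vhSAt, packVH_inl_inr, if_neg hz, mul_zero]

/-- [folklore] `S₀ κ u (x, inr m; z, inl β) = 0` unless `off Lc x = 0`. -/
theorem Spure0_inr_inl_of_off (cΛ : ℝ) (κ : Fin 4) (u x z : Fin 4 → ℤ) (m β : Fin 4) (hx : off Lc x ≠ 0) :
    SpureRecAt 3 Lc (toSite (ctrOff 4 Lc)) ((Lc : ℝ) ^ 4) (-((Lc : ℝ) ^ 8 / 2)) cΛ 0 κ u x z (Sum.inr m) (Sum.inl β) = 0 := by
  simp only [SpureRecAt_zero_level, Pi.add_apply, Pi.smul_apply, smul_eq_mul, wilsonA_inr_inl, mul_zero, zero_add]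
  rw [AveragingHessianKernelsRooted.vhSAt, packVH_inr_inl, if_neg hx, mul_zero]

/-- [folklore] `𝕄₀ (x, inl β; z, inr m) = 0` unless `off Lc z = 0`. -/
theorem bhK0_inl_inr_of_off (x z : Fin 4 → ℤ) (β m : Fin 4) (hz : off Lc z ≠ 0) :
    bhKStepAt 3 (toSite (ctrOff 4 Lc)) Lc 0 x z (Sum.inl β) (Sum.inr m) = 0 := by
  rw [bhKStepAt_zero, bhKAt_inl_inr_eq_linSymAt, linSymAt_inl_inr, if_neg hz, mul_zero]

/-- [folklore] `𝕄₀ (x, inr m; z, inl β) = 0` unless `off Lc x = 0`. -/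
theorem bhK0_inr_inl_of_off (x z : Fin 4 → ℤ) (m β : Fin 4) (hx : off Lc x ≠ 0) :
    bhKStepAt 3 (toSite (ctrOff 4 Lc)) Lc 0 x z (Sum.inr m) (Sum.inl β) = 0 := by
  rw [bhKStepAt_zero, bhKAt_inr_inl_eq_linSymAt, linSymAt_inr_inl, if_neg hx, mul_zero]

/-! ## §3 The three remaining wall instances -/

section Wall

variable (hLc : Odd Lc) (cΛ : ℝ) (γ : ℕ → ℝ)
  (hγ : ∀ j, γ j = -((Lc : ℝ) ^ 8 / 2) * wVH 3 Lc j / (stepScale 3 Lc j * (Lc : ℝ) ^ 4)) (α : Fin 4)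

include hLc hγ

/-- [folklore] Scale relation of the wall: `Lc⁻⁴ · γ 0 = −½`. -/
theorem wall_scale : ((Lc : ℝ) ^ 4)⁻¹ * γ 0 = -(1 / 2 : ℝ) := by
  have hL : (Lc : ℝ) ≠ 0 := by exact_mod_cast NeZero.ne Lc
  have _ := hLc
  rw [gamma_zero_eq γ hγ]; field_simp

/-- [folklore] **WALL INSTANCE, mirror block `(x, inr m; z, inl β)`, `m ≠ α`.** -/
theorem wallD₀_ward_eq_defect_inr_inl {m : Fin 4} (hm : m ≠ α) (Y : Fin 4 → ℤ) (κ' : Fin 4) (u' x z : Fin 4 → ℤ) (β : Fin 4) :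
    ((((Lc : ℝ) ^ 4)⁻¹) • ∑ v ∈ box 4 Lc, divV (fun κ u => wallD₀ Lc cΛ γ α κ u κ' u') ((Lc : ℤ) • Y + toSite v)) x z (Sum.inr m) (Sum.inl β) =
      (reflSign α κ' • refK (Φ (d := 3) Lc α)
          (conjV (SpureRecAt 3 Lc (toSite (ctrOff 4 Lc)) ((Lc : ℝ) ^ 4) (-((Lc : ℝ) ^ 8 / 2)) cΛ 0 κ' (bref α κ' u'))
            (diagK ((1 / 2 : ℝ) • ∑ v ∈ box 4 Lc, legInd (toSite (ctrOff 4 Lc)) ((Lc : ℤ) • sref α Y + toSite v)))) -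
        conjV (SpureRecAt 3 Lc (toSite (ctrOff 4 Lc)) ((Lc : ℝ) ^ 4) (-((Lc : ℝ) ^ 8 / 2)) cΛ 0 κ' u')
          (diagK ((1 / 2 : ℝ) • ∑ v ∈ box 4 Lc, legInd (toSite (ctrOff 4 Lc)) ((Lc : ℤ) • Y + toSite v))))
        x z (Sum.inr m) (Sum.inl β) :=
  canonD_ward_eq_defect_inr_inl Lc α (γ 0) (((Lc : ℝ) ^ 4)⁻¹) _ _ hLc hm (wall_scale hLc γ hγ)
    (actS_SpureRecAt_zero hLc cΛ γ hγ α) (fun Y x z β => sum_divV_Spure0_inr_inl cΛ γ hγ Y x z m β) Y κ' u' x z β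

/-- [folklore] **WALL INSTANCE, axis block `(x, inl β; z, inr α)`.** -/
theorem wallD₀_ward_eq_defect_inl_inr_axis (Y : Fin 4 → ℤ) (κ' : Fin 4) (u' x z : Fin 4 → ℤ) (β : Fin 4) :
    ((((Lc : ℝ) ^ 4)⁻¹) • ∑ v ∈ box 4 Lc, divV (fun κ u => wallD₀ Lc cΛ γ α κ u κ' u') ((Lc : ℤ) • Y + toSite v)) x z (Sum.inl β) (Sum.inr α) =
      (reflSign α κ' • refK (Φ (d := 3) Lc α)
          (conjV (SpureRecAt 3 Lc (toSite (ctrOff 4 Lc)) ((Lc : ℝ) ^ 4) (-((Lc : ℝ) ^ 8 / 2)) cΛ 0 κ' (bref α κ' u'))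
            (diagK ((1 / 2 : ℝ) • ∑ v ∈ box 4 Lc, legInd (toSite (ctrOff 4 Lc)) ((Lc : ℤ) • sref α Y + toSite v)))) -
        conjV (SpureRecAt 3 Lc (toSite (ctrOff 4 Lc)) ((Lc : ℝ) ^ 4) (-((Lc : ℝ) ^ 8 / 2)) cΛ 0 κ' u')
          (diagK ((1 / 2 : ℝ) • ∑ v ∈ box 4 Lc, legInd (toSite (ctrOff 4 Lc)) ((Lc : ℤ) • Y + toSite v))))
        x z (Sum.inl β) (Sum.inr α) :=
  canonD_ward_eq_defect_inl_inr_axis Lc α (γ 0) (((Lc : ℝ) ^ 4)⁻¹) _ _ hLc (wall_scale hLc γ hγ)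
    (fun κ u x z β hz => Spure0_inl_inr_of_off cΛ κ u x z β α hz) (fun x z β hz => bhK0_inl_inr_of_off x z β α hz)
    (actS_SpureRecAt_zero hLc cΛ γ hγ α) (fun Y x z β => sum_divV_Spure0_inl_inr cΛ γ hγ Y x z β α) Y κ' u' x z β

/-- [folklore] **WALL INSTANCE, mirror axis block `(x, inr α; z, inl β)`.** -/
theorem wallD₀_ward_eq_defect_inr_inl_axis (Y : Fin 4 → ℤ) (κ' : Fin 4) (u' x z : Fin 4 → ℤ) (β : Fin 4) :
    ((((Lc : ℝ) ^ 4)⁻¹) • ∑ v ∈ box 4 Lc, divV (fun κ u => wallD₀ Lc cΛ γ α κ u κ' u') ((Lc : ℤ) • Y + toSite v)) x z (Sum.inr α) (Sum.inl β) =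
      (reflSign α κ' • refK (Φ (d := 3) Lc α)
          (conjV (SpureRecAt 3 Lc (toSite (ctrOff 4 Lc)) ((Lc : ℝ) ^ 4) (-((Lc : ℝ) ^ 8 / 2)) cΛ 0 κ' (bref α κ' u'))
            (diagK ((1 / 2 : ℝ) • ∑ v ∈ box 4 Lc, legInd (toSite (ctrOff 4 Lc)) ((Lc : ℤ) • sref α Y + toSite v)))) -
        conjV (SpureRecAt 3 Lc (toSite (ctrOff 4 Lc)) ((Lc : ℝ) ^ 4) (-((Lc : ℝ) ^ 8 / 2)) cΛ 0 κ' u')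
          (diagK ((1 / 2 : ℝ) • ∑ v ∈ box 4 Lc, legInd (toSite (ctrOff 4 Lc)) ((Lc : ℤ) • Y + toSite v))))
        x z (Sum.inr α) (Sum.inl β) :=
  canonD_ward_eq_defect_inr_inl_axis Lc α (γ 0) (((Lc : ℝ) ^ 4)⁻¹) _ _ hLc (wall_scale hLc γ hγ)
    (fun κ u x z β hx => Spure0_inr_inl_of_off cΛ κ u x z α β hx) (fun x z β hx => bhK0_inr_inl_of_off x z α β hx)
    (actS_SpureRecAt_zero hLc cΛ γ hγ α) (fun Y x z β => sum_divV_Spure0_inr_inl cΛ γ hγ Y x z α β) Y κ' u' x z β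

end Wall

end

end Summit.QuantumFields.BalabanUV.Beta.WardBorderReflectionWallBlocks
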